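import Mathlib
import Summits.AtomisticToContinuum.HydrodynamicLimit.Theorems.RelayRaceLocalityNearConstantShortTimeHLDensityRow
import Literature.Analysis.FunctionSpaces.TorusSpaceTimeExtension
import Literature.Analysis.FunctionSpaces.TorusSpaceTime
import Literature.Analysis.FluidPDE.BilliardTensorMeasureDivFree
import Literature.MathematicalPhysics.KineticTheory.HardSphereEulerPrimitiveForm
import HarnessLib

/-!
# Crux `NearConstantShortTimeHL` (stmt-AtomisticToContinuum-12502), line `small-tilt-domination`:
# tests built from the Euler solution (smooth on `[0, T) × 𝕋³` only)

Lead c3, wave 1, stubs `densityRow_balance_flow_Ico`, `isSmoothSpaceTimeOn_logProfileRows`,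
`timeDerivWithin_Ico_eq_of_le`, `timeDerivWithin_Icc_eq_of_isSmoothSpaceTimeOn` of the Grönwall
assembly.  The assembly expands the log-profile observable along hard-sphere orbits; the test
fields it pairs with the empirical measure are built from a classical hard-sphere–Euler solution
and are therefore jointly smooth only on the half-open slab `[0, T) × 𝕋³`
(`Torus.IsSmoothSpaceTimeOn (Ico 0 T)`), whereas the landed weak mass balance along the flow
(`densityRow_balance_flow`, Serre's `Div M = σ^a − σ^b` with zero vector test) wants a globally
`C¹` space–time test.  Here:

* `stFDeriv_apply_one_eq_timeDeriv_add_sum` — for a globally `C¹` scalar test,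
  `Dψ(r, x)(1, v) = ∂ₜψ(r, x) + Σₖ ∂ₖψ(r, ·)(x) vₖ`;
* `densityRow_balance_flow_Ico` — the mass row of the weak balance law along a good orbit for a
  test smooth on `[0, T) × 𝕋³`, on windows `0 ≤ a ≤ b < T`, with the one-sided time derivative
  `Torus.timeDerivWithin (Ico 0 T)` in the integrand (proof: replace `φ` by its global `C¹`
  extension off `[0, T'] × 𝕋³`, `b < T' < T`, `Torus.IsSmoothSpaceTimeOn.exists_contDiff_one_extension`,
  and identify the integrands on `Ioc a b ⊆ Ioo 0 T'`);
* `isSmoothSpaceTimeOn_logProfileRows` — the three log-profile rows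
  `log ρ + (f_ex(ρσ³) + ρσ³ f_ex'(ρσ³)) − (3/2) log(2πθ) − |u|²/(2θ)`, `u/θ`, `−1/θ` of a classical
  solution are jointly smooth on `[0, t') × 𝕋³` as long as the packing `ρσ³` stays in the band
  `[0, η₀)` on which the excess free energy is real analytic;
* `timeDerivWithin_Ico_eq_of_le`, `timeDerivWithin_Icc_eq_of_isSmoothSpaceTimeOn` — the
  one-sided time derivatives within `[0, t')`, resp. within a closed window `[s, s'] ⊆ [0, T)`,
  agree with the ones within `[0, T)`.

No definitions, no named facts.
-/

noncomputable section

namespace Summit.AtomisticToContinuum.HydrodynamicLimit.Theorems.NearConstantShortTimeHL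

open scoped BigOperators ENNReal Topology
open MeasureTheory Set Filter
open Literature.MathematicalPhysics.KineticTheory Literature.Analysis.FluidPDE Literature.Analysis.FunctionSpaces

/-! ### One-sided time derivatives within nested time sets -/

/-- Time derivatives within `[0, t')` and within `[0, T)` agree on `[0, t')` for `t' ≤ T`: the two
time sets coincide near every `r < t'` (Mathlib `derivWithin_inter`). No differentiability is
needed. [folklore] -/
theorem timeDerivWithin_Ico_eq_of_le : ∀ {F' : Type*} [NormedAddCommGroup F'] [NormedSpace ℝ F'] {T t' : ℝ}, t' ≤ T → ∀ (f : ℝ → T3 → F') {r : ℝ}, r ∈ Set.Ico 0 t' → ∀ x : T3, Torus.timeDerivWithin (Set.Ico 0 t') f r x = Torus.timeDerivWithin (Set.Ico 0 T) f r x := by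
  intro F' _ _ T t' ht' f r hr x
  have hset : Set.Ico (0 : ℝ) t' = Set.Ico 0 T ∩ Set.Iio t' := by
    ext τ
    simp only [Set.mem_Ico, Set.mem_inter_iff, Set.mem_Iio]
    exact ⟨fun h => ⟨⟨h.1, h.2.trans_le ht'⟩, h.2⟩, fun h => ⟨h.1.1, h.2⟩⟩
  unfold Torus.timeDerivWithin
  rw [hset, derivWithin_inter (Iio_mem_nhds hr.2)]

/-- Within a closed window `[s, s']`, `0 ≤ s < s' < T`, the one-sided time derivatives of a field
jointly smooth on `[0, T) × 𝕋³` agree with the ones within `[0, T)` (including at the endpoints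
`s`, `s'`): the slice is differentiable within `[0, T) ⊇ [s, s']` and `[s, s']` is a set of unique
differentiability. [folklore] -/
theorem timeDerivWithin_Icc_eq_of_isSmoothSpaceTimeOn : ∀ {F' : Type*} [NormedAddCommGroup F'] [NormedSpace ℝ F'] {T s s' : ℝ} {f : ℝ → T3 → F'}, Torus.IsSmoothSpaceTimeOn (Set.Ico 0 T) f → 0 ≤ s → s < s' → s' < T → ∀ {r : ℝ}, r ∈ Set.Icc s s' → ∀ x : T3, Torus.timeDerivWithin (Set.Icc s s') f r x = Torus.timeDerivWithin (Set.Ico 0 T) f r x := by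
  intro F' _ _ T s s' f hf hs hss' hs' r hr x
  have hsub : Set.Icc s s' ⊆ Set.Ico 0 T := fun τ hτ => ⟨hs.trans hτ.1, hτ.2.trans_lt hs'⟩
  exact ((hf.hasDerivWithinAt_slice (hsub hr) x).mono hsub).derivWithin (uniqueDiffOn_Icc hss' r hr)

/-! ### The mass row of the weak balance law for tests smooth on `[0, T) × 𝕋³` -/

/-- For a globally `C¹` space–time scalar test `ψ` on `ℝ × 𝕋³`, the space–time derivative along
`(1, v)` is the two-sided time derivative plus the directional space derivative:
`Dψ(r, x)(1, v) = ∂ₜψ(r, x) + Σₖ ∂ₖ(ψ r)(x) vₖ` (`(1, v) = (1, 0) + (0, v)`; the `(1, 0)` part is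
the chain rule along the trivial flight `Torus.hasDerivAt_stLift_flight` with `v = 0`, the
`(0, v)` part is `Torus.stFDeriv_inr` and `Torus.fderiv_apply_eq_sum_partialDeriv`). [folklore] -/
theorem stFDeriv_apply_one_eq_timeDeriv_add_sum {ψ : ℝ → T3 → ℝ}
    (hψ : ContDiff ℝ 1 (Torus.stLift ψ)) (r : ℝ) (x : T3) (v : V3) :
    Torus.stFDeriv ψ r x (1, v) = Torus.timeDeriv ψ r x + ∑ k, Torus.partialDeriv k (ψ r) x * v k := by
  have hsplit : ((1 : ℝ), v) = ((1 : ℝ), (0 : V3)) + ((0 : ℝ), v) := by simp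
  have htime : Torus.timeDeriv ψ r x = Torus.stFDeriv ψ r x (1, 0) := by
    have h := Torus.hasDerivAt_stLift_flight hψ x (0 : V3) 0 r
    simp only [smul_zero, Torus.proj_zero, add_zero] at h
    exact h.deriv
  have hspace : Torus.stFDeriv ψ r x (0, v) = ∑ k, Torus.partialDeriv k (ψ r) x * v k := by
    rw [Torus.stFDeriv_inr hψ r x v,
      Torus.fderiv_apply_eq_sum_partialDeriv (Torus.isContDiff_slice_of_stLift hψ r) x v]
    exact Finset.sum_congr rfl fun k _ => by rw [smul_eq_mul, mul_comm]
  rw [hsplit, map_add, htime, hspace]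

/-- **The mass row of the weak balance law along the flow, for tests smooth on `[0, T) × 𝕋³`**
(registered stub `densityRow_balance_flow_Ico`).  For a hard-sphere flow `Φ` on `𝕋³`, a good
initial datum `z`, a scalar test `φ` jointly smooth on `[0, T) × 𝕋³` and a window
`0 ≤ a ≤ b < T`, the streaming integrand `Σᵢ (∂ₜφ + vᵢ·∇φ)(r, xᵢ(r))` (one-sided time derivative
within `[0, T)`) is interval integrable on `[a, b]` and
`Σᵢ φ(b, xᵢ(b)) − Σᵢ φ(a, xᵢ(a)) = ∫_a^b Σᵢ (∂ₜφ + vᵢ·∇φ)(r, xᵢ(r)) dr`.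
Proof: `φ` agrees on `[0, T'] × 𝕋³`, `T' = (b + T)/2`, with a globally `C¹` test `ψ`
(`Torus.IsSmoothSpaceTimeOn.exists_contDiff_one_extension`); apply the landed
`densityRow_balance_flow` to `ψ` and identify the integrands on `Ioc a b ⊆ Ioo 0 T'`.
[cite: Serre2024, §5 (16)] -/
theorem densityRow_balance_flow_Ico : ∀ {ε : ℝ} {N : ℕ} (Φ : HardSphereFlow (Torus.geometry (Fin 3)) ε N) {z : Config N (Fin 3) T3}, z ∈ Φ.good → ∀ {T : ℝ} {φ : ℝ → T3 → ℝ}, Torus.IsSmoothSpaceTimeOn (Set.Ico 0 T) φ → ∀ {a b : ℝ}, 0 ≤ a → a ≤ b → b < T → IntervalIntegrable (fun r => ∑ i, (Torus.timeDerivWithin (Set.Ico 0 T) φ r ((Φ.flow r z) i).1 + ∑ k, Torus.partialDeriv k (φ r) ((Φ.flow r z) i).1 * ((Φ.flow r z) i).2 k)) volume a b ∧ ((∑ i, φ b ((Φ.flow b z) i).1) - ∑ i, φ a ((Φ.flow a z) i).1) = ∫ r in a..b, ∑ i, (Torus.timeDerivWithin (Set.Ico 0 T) φ r ((Φ.flow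 r z) i).1 + ∑ k, Torus.partialDeriv k (φ r) ((Φ.flow r z) i).1 * ((Φ.flow r z) i).2 k) := by
  intro ε N Φ z hz T φ hφ a b ha hab hb
  -- an intermediate horizon `b < T' = (b + T)/2 < T`, `0 < T'`
  have hbT' : b < (b + T) / 2 := by linarith
  have hT'T : (b + T) / 2 < T := by linarith
  have hT'0 : 0 < (b + T) / 2 := lt_of_le_of_lt (ha.trans hab) hbT'
  obtain ⟨ψ, hψ, hψφ, hψφ'⟩ := hφ.exists_contDiff_one_extension hT'0 hT'T
  obtain ⟨hint, heq⟩ := densityRow_balance_flow Φ hz hψ hab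
  -- the two integrands agree on `Ioc a b ⊆ Ioo 0 T'`
  have hagree : EqOn (fun r => ∑ i, Torus.stFDeriv ψ r ((Φ.flow r z) i).1 (1, ((Φ.flow r z) i).2))
      (fun r => ∑ i, (Torus.timeDerivWithin (Set.Ico 0 T) φ r ((Φ.flow r z) i).1 +
        ∑ k, Torus.partialDeriv k (φ r) ((Φ.flow r z) i).1 * ((Φ.flow r z) i).2 k)) (Ioc a b) := by
    intro r hr
    have hr0 : 0 < r := ha.trans_lt hr.1
    have hrT' : r < (b + T) / 2 := hr.2.trans_lt hbT'
    have hslice : ψ r = φ r := funext fun y => hψφ r ⟨hr0.le, hrT'.le⟩ y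
    have hinter : r ∈ interior (Set.Ico (0 : ℝ) T) := by
      rw [interior_Ico]
      exact ⟨hr0, hrT'.trans hT'T⟩
    refine Finset.sum_congr rfl fun i _ => ?_
    rw [stFDeriv_apply_one_eq_timeDeriv_add_sum hψ, hψφ' r ⟨hr0, hrT'⟩,
      ← Torus.timeDerivWithin_of_mem_interior hinter, hslice]
  refine ⟨?_, ?_⟩
  · rw [intervalIntegrable_iff_integrableOn_Ioc_of_le hab] at hint ⊢
    exact hint.congr_fun hagree measurableSet_Ioc
  · have hsb : ∑ i, ψ b ((Φ.flow b z) i).1 = ∑ i, φ b ((Φ.flow b z) i).1 :=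
      Finset.sum_congr rfl fun i _ => hψφ b ⟨ha.trans hab, hbT'.le⟩ _
    have hsa : ∑ i, ψ a ((Φ.flow a z) i).1 = ∑ i, φ a ((Φ.flow a z) i).1 :=
      Finset.sum_congr rfl fun i _ => hψφ a ⟨ha, hab.trans hbT'.le⟩ _
    rw [hsb, hsa] at heq
    rw [heq]
    exact intervalIntegral.integral_congr_ae
      (Eventually.of_forall fun r hr => hagree (by rwa [uIoc_of_le hab] at hr))

/-! ### Smoothness of the log-profile rows of a classical solution -/

/-- **The three log-profile rows of a classical hard-sphere–Euler solution are jointly smooth**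
(registered stub `isSmoothSpaceTimeOn_logProfileRows`).  If the excess free energy agrees on
`[0, η₀)` with a function `F` real analytic on `(-η₀, η₀)`, then along a classical solution on
`[0, T) × 𝕋³` whose packing `ρσ³` stays `< η₀` on `[0, t') × 𝕋³`, `t' ≤ T`, the fields
`log ρ + (f_ex(ρσ³) + ρσ³ f_ex'(ρσ³)) − (3/2) log(2πθ) − |u|²/(2θ)`, `θ⁻¹ u` and `−θ⁻¹` are
jointly smooth on `[0, t') × 𝕋³`: `ρ, θ > 0` and `ρ, u, θ` are jointly smooth (structure fields),
the packing takes values in the OPEN band `(0, η₀)` on which `f_ex = F` is `C^∞` together with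
its derivative, and smoothness is preserved by `log`, inverse, products and composition
(`HsEulerCalc.isSmoothSpaceTimeOn_comp_density`). [folklore] -/
theorem isSmoothSpaceTimeOn_logProfileRows : ∀ {η₀ : ℝ} {F : ℝ → ℝ}, 0 < η₀ → AnalyticOnNhd ℝ F (Set.Ioo (-η₀) η₀) → Set.EqOn hsExcessFreeEnergy F (Set.Ico 0 η₀) → ∀ {σ T : ℝ}, 0 < σ → ∀ {ρ θ : ℝ → T3 → ℝ} {u : ℝ → T3 → V3}, IsHardSphereEulerSolution σ T ρ u θ → ∀ {t' : ℝ}, t' ≤ T → (∀ s ∈ Set.Ico 0 t', ∀ x, ρ s x * σ ^ 3 < η₀) → Torus.IsSmoothSpaceTimeOn (Set.Ico 0 t') (fun s y => Real.log (ρ s y) + (hsExcessFreeEnergy (ρ s y * σ ^ 3) + ρ s y * σ ^ 3 * deriv hsExcessFreeEnergy (ρ s y * σ ^ 3)) - 3 / 2 * Real.log (2 * Real.pi * θ s y) - ‖u s y‖ ^ 2 / (2 * θ s y)) ∧ Torus.IsSmoothSpaceTimeOn (Set.Ico 0 t') (fun s y => (θ s y)⁻¹ • u s y) ∧ Torus.IsSmoothSpaceTimeOn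 (Set.Ico 0 t') (fun s y => -(θ s y)⁻¹) := by
  intro η₀ F hη₀ hFa hEq σ T hσ ρ θ u hE t' ht' hband
  have hsub : Set.Ico (0 : ℝ) t' ⊆ Set.Ico 0 T := Set.Ico_subset_Ico_right ht'
  -- the basic fields on the smaller slab
  have hρ : Torus.IsSmoothSpaceTimeOn (Set.Ico 0 t') ρ := hE.smooth_density.mono hsub
  have hθ : Torus.IsSmoothSpaceTimeOn (Set.Ico 0 t') θ := hE.smooth_temperature.mono hsub
  have hu : Torus.IsSmoothSpaceTimeOn (Set.Ico 0 t') u := hE.smooth_velocity.mono hsub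
  have hρne : ∀ p ∈ Set.Ico (0 : ℝ) t' ×ˢ (Set.univ : Set V3), Torus.stLift ρ p ≠ 0 := fun p hp =>
    (hE.density_pos p.1 (hsub (Set.mem_prod.1 hp).1) _).ne'
  have hθpos : ∀ p ∈ Set.Ico (0 : ℝ) t' ×ˢ (Set.univ : Set V3), 0 < Torus.stLift θ p := fun p hp =>
    hE.temperature_pos p.1 (hsub (Set.mem_prod.1 hp).1) _
  -- constants
  have hc : ∀ c : ℝ, Torus.IsSmoothSpaceTimeOn (Set.Ico 0 t') (fun (_ : ℝ) (_ : T3) => c) :=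
    fun c => contDiffOn_const
  -- the equation of state is smooth, with its derivative, on the open band `(0, η₀)`
  have hex : ContDiffOn ℝ ((⊤ : ℕ∞) : WithTop ℕ∞) hsExcessFreeEnergy (Set.Ioo 0 η₀) := by
    have hF : ContDiffOn ℝ ((⊤ : ℕ∞) : WithTop ℕ∞) F (Set.Ioo 0 η₀) :=
      hFa.contDiffOn_of_completeSpace.mono (Set.Ioo_subset_Ioo_left (neg_nonpos.2 hη₀.le))
    exact hF.congr fun a ha => hEq ⟨ha.1.le, ha.2⟩
  have hex' : ContDiffOn ℝ ((⊤ : ℕ∞) : WithTop ℕ∞) (deriv hsExcessFreeEnergy) (Set.Ioo 0 η₀) :=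
    hex.deriv_of_isOpen isOpen_Ioo le_rfl
  -- the packing field and its composites with the equation of state
  have hpack : Torus.IsSmoothSpaceTimeOn (Set.Ico 0 t') (fun s y => ρ s y * σ ^ 3) :=
    hρ.mul (hc (σ ^ 3))
  have hbandJ : ∀ s ∈ Set.Ico (0 : ℝ) t', ∀ x, ρ s x * σ ^ 3 ∈ Set.Ioo 0 η₀ := fun s hs x =>
    ⟨mul_pos (hE.density_pos s (hsub hs) x) (pow_pos hσ 3), hband s hs x⟩
  have h1 : Torus.IsSmoothSpaceTimeOn (Set.Ico 0 t') (fun s y => hsExcessFreeEnergy (ρ s y * σ ^ 3)) :=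
    HsEulerCalc.isSmoothSpaceTimeOn_comp_density hpack hex hbandJ
  have h2 : Torus.IsSmoothSpaceTimeOn (Set.Ico 0 t')
      (fun s y => deriv hsExcessFreeEnergy (ρ s y * σ ^ 3)) :=
    HsEulerCalc.isSmoothSpaceTimeOn_comp_density hpack hex' hbandJ
  -- logarithms, inverse temperature, kinetic term
  have hlogρ : Torus.IsSmoothSpaceTimeOn (Set.Ico 0 t') (fun s y => Real.log (ρ s y)) :=
    ContDiffOn.log hρ hρne
  have h2πθ : Torus.IsSmoothSpaceTimeOn (Set.Ico 0 t') (fun s y => 2 * Real.pi * θ s y) :=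
    (hc (2 * Real.pi)).mul hθ
  have hlogθ : Torus.IsSmoothSpaceTimeOn (Set.Ico 0 t') (fun s y => Real.log (2 * Real.pi * θ s y)) :=
    ContDiffOn.log h2πθ fun p hp => (mul_pos (mul_pos two_pos Real.pi_pos) (hθpos p hp)).ne'
  have hD : Torus.IsSmoothSpaceTimeOn (Set.Ico 0 t')
      (fun s y => 3 / 2 * Real.log (2 * Real.pi * θ s y)) := (hc (3 / 2)).mul hlogθ
  have hθinv : Torus.IsSmoothSpaceTimeOn (Set.Ico 0 t') (fun s y => (θ s y)⁻¹) :=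
    ContDiffOn.fun_inv hθ fun p hp => (hθpos p hp).ne'
  have h2θ : Torus.IsSmoothSpaceTimeOn (Set.Ico 0 t') (fun s y => 2 * θ s y) := (hc 2).mul hθ
  have hkin : Torus.IsSmoothSpaceTimeOn (Set.Ico 0 t') (fun s y => ‖u s y‖ ^ 2 / (2 * θ s y)) :=
    ContDiffOn.fun_div (hu.norm_sq ℝ) h2θ fun p hp => (mul_pos two_pos (hθpos p hp)).ne'
  exact ⟨((hlogρ.add (h1.add (hpack.mul h2))).sub hD).sub hkin, hθinv.smul hu, hθinv.neg⟩

end Summit.AtomisticToContinuum.HydrodynamicLimit.Theorems.NearConstantShortTimeHL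

end
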